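import Mathlib
import Literature.AlgebraicGeometry.Resolution.AdicCompletionInitialForms
import HarnessLib

/-!
# No permissible formal surface: `I R̂ ⊄ (z^μ)` for a regular parameter `z` of `R̂`

Topic: `Literature/AlgebraicGeometry/Resolution`. The height-one companion of `isolated_map_adicCompletion`
(`AdicCompletionInitialForms`, brick B1): along the flat local maps `R_𝔮 → R̂_𝔓`, `𝔮 = 𝔓 ∩ R`, whose
closed fibres are regular (`R` a G-ring), `ord` is preserved (Matsumura, *Commutative Ring Theory*, §32
p. 256; Cossart–Piltant 2008, proof of Prop. 4.4 p. 11: the singular locus `V(I)` of the idealistic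
exponent keeps dimension `≤ 1` along the resolution sequence), applied to the HEIGHT-ONE formal prime
`𝔓 = (z)` of a regular parameter `z` of `R̂`: its contraction `𝔮` contains no two members of a regular
system of parameters of `R` (they would generate `𝔪̂` together with one more element modulo `(z)`),
so it is neither `𝔪` nor the centre of a permissible curve. Consequence used by the completed-chain
descent (OPTION R, clause `hNS′` of `completedChain_nonRational_step`): the weak transform admits no
permissible formal surface, which is what re-total-preparation in `R̂`
(`TotalPreparation.exists_preparedUpTo_forall_of_forall_not_le`) needs. PROVED (no facts, no definitions):

* `not_span_pair_eq_maximalIdeal_of_dim_three` — `𝔪` of a three-dimensional regular local ring is not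
  generated by two elements;
* `not_map_adicCompletion_le_span_pow` — **`I R̂ ⊄ (c′₀^μ)` for every regular system `c′` of `R̂`**, from
  the `hqis`-form hypothesis at the primes of `R` containing no pair of a regular system of parameters.

AI-written; weaker than expert review. F-71 / T1 / N2 NOT proved; no summit statement is proved.

## Sources

* H. Matsumura, *Commutative Ring Theory*, §32 (p. 256), Thm. 8.11. [Matsumura1987]
* V. Cossart, O. Piltant, J. Algebra 320 (2008), proof of Prop. 4.4, p. 11. [CossartPiltant2008]
* V. Cossart, U. Jannsen, S. Saito, LNM 2270 (2020), Thm. 8.24. [CossartJannsenSaito2020]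
-/

noncomputable section

open IsLocalRing

namespace Literature.AlgebraicGeometry.Resolution

universe u

section NoSurface

variable {R : Type u} [CommRing R] [IsRegularLocalRing R]

/-- The maximal ideal of a three-dimensional regular local ring is not generated by two elements.
[cite: Matsumura1987, Thm. 14.2] -/
theorem not_span_pair_eq_maximalIdeal_of_dim_three (hdim : ringKrullDim R = 3) (a b : R) :
    Ideal.span ({a, b} : Set R) ≠ maximalIdeal R := by
  intro heq
  have hfr : (maximalIdeal R).spanFinrank = 3 := by
    have h := IsRegularLocalRing.spanFinrank_maximalIdeal (R := R)
    rw [hdim] at h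
    exact_mod_cast h
  have hfin : ({a, b} : Set R).Finite := Set.toFinite _
  have hcard : (Ideal.span ({a, b} : Set R)).spanFinrank ≤ ({a, b} : Set R).ncard :=
    Submodule.spanFinrank_span_le_ncard_of_finite hfin
  have h2 : ({a, b} : Set R).ncard ≤ 2 := (Set.ncard_insert_le _ _).trans (by rw [Set.ncard_singleton])
  rw [heq, hfr] at hcard
  omega

/-- **`I R̂ ⊄ (c′₀^μ)` for every regular system `c′` of `R̂`** («no permissible formal surface»), for a
three-dimensional regular local G-ring `R` and an ideal `I` with `ord_𝔮 I < μ` at every non-maximal prime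
`𝔮` of `R` containing no two members of a regular system of parameters (the `hqis` clause of the completed
chain at a curve level, whose centre `(y, u)` is excluded, implies this). [cite: Matsumura1987, §32 (p. 256)]
[cite: CossartPiltant2008, Prop. 4.4 (proof, p. 11)] [cite: CossartJannsenSaito2020, Thm. 8.24] -/
theorem not_map_adicCompletion_le_span_pow (hG : IsGRing R) (hdim : ringKrullDim R = 3) {I : Ideal R} {μ : ℕ}
    (hq : ∀ (𝔮 : Ideal R) [𝔮.IsPrime], 𝔮 ≠ maximalIdeal R →
      (∀ y v w : R, Ideal.span {y, v, w} = maximalIdeal R → y ∈ 𝔮 → v ∈ 𝔮 → False) →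
      ¬ I.map (algebraMap R (Localization.AtPrime 𝔮)) ≤ maximalIdeal (Localization.AtPrime 𝔮) ^ μ)
    [IsRegularLocalRing (AdicCompletion (maximalIdeal R) R)]
    (c' : Fin 3 → AdicCompletion (maximalIdeal R) R)
    (hc' : Ideal.span {c' 0, c' 1, c' 2} = maximalIdeal (AdicCompletion (maximalIdeal R) R)) :
    ¬ I.map (algebraMap R (AdicCompletion (maximalIdeal R) R)) ≤ Ideal.span {c' 0 ^ μ} := by
  classical
  intro hle
  have hdimA : ringKrullDim (AdicCompletion (maximalIdeal R) R) = 3 := by rw [ringKrullDim_adicCompletion, hdim]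
  haveI : IsDomain (AdicCompletion (maximalIdeal R) R) := isDomain_of_isRegularLocalRing _
  set 𝔓 : Ideal (AdicCompletion (maximalIdeal R) R) := Ideal.span {c' 0} with h𝔓def
  -- `𝔓 = (c′₀)` is prime and not maximal
  have hfrA : (maximalIdeal (AdicCompletion (maximalIdeal R) R)).spanFinrank = 3 := by
    have h := IsRegularLocalRing.spanFinrank_maximalIdeal (R := AdicCompletion (maximalIdeal R) R)
    rw [hdimA] at h
    exact_mod_cast h
  have hc'r := span_range_eq_of_span_triple c' hc'
  haveI h𝔓prime : 𝔓.IsPrime := by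
    have := isPrime_span_image hfrA c' hc'r {0}
    simpa [h𝔓def] using this
  have h𝔓ne : 𝔓 ≠ maximalIdeal (AdicCompletion (maximalIdeal R) R) := by
    intro heq
    refine not_span_pair_eq_maximalIdeal_of_dim_three hdimA (c' 0) (c' 0) ?_
    rw [← heq, h𝔓def]
    congr 1
    simp
  have hleP : I.map (algebraMap R (AdicCompletion (maximalIdeal R) R)) ≤ 𝔓 ^ μ := by
    rw [h𝔓def, Ideal.span_singleton_pow]; exact hle
  -- the contraction `𝔮 = 𝔓 ∩ R`
  set 𝔮 : Ideal R := 𝔓.under R with h𝔮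
  have h𝔮ne : 𝔮 ≠ maximalIdeal R := by
    intro heq
    apply h𝔓ne
    refine ((maximalIdeal.isMaximal _).eq_of_le (Ideal.IsPrime.ne_top ‹_›) ?_).symm
    rw [AdicCompletion.maximalIdeal_eq_map, Ideal.map_le_iff_le_comap]
    intro r hr
    change r ∈ 𝔓.under R
    rw [← h𝔮, heq]
    exact hr
  -- `𝔮` contains no two members of a regular system of parameters of `R`
  have hpair : ∀ y v w : R, Ideal.span {y, v, w} = maximalIdeal R → y ∈ 𝔮 → v ∈ 𝔮 → False := by
    intro y v w hgen hy hv
    -- `ι y, ι v ∈ (c′₀)`, so `𝔪̂ = (ι y, ι v, ι w) ⊆ (c′₀, ι w)`: two generators, impossible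
    have hy' : algebraMap R (AdicCompletion (maximalIdeal R) R) y ∈ 𝔓 := hy
    have hv' : algebraMap R (AdicCompletion (maximalIdeal R) R) v ∈ 𝔓 := hv
    have hmA : maximalIdeal (AdicCompletion (maximalIdeal R) R) =
        Ideal.span {algebraMap R _ y, algebraMap R _ v, algebraMap R (AdicCompletion (maximalIdeal R) R) w} := by
      rw [AdicCompletion.maximalIdeal_eq_map, ← hgen, Ideal.map_span, Set.image_insert_eq, Set.image_insert_eq,
        Set.image_singleton]
    refine not_span_pair_eq_maximalIdeal_of_dim_three hdimA (c' 0)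
      (algebraMap R (AdicCompletion (maximalIdeal R) R) w) (le_antisymm ?_ ?_)
    · rw [Ideal.span_le, Set.insert_subset_iff, Set.singleton_subset_iff]
      refine ⟨?_, ?_⟩
      · rw [← hc']; exact Ideal.subset_span (by simp)
      · rw [hmA]; exact Ideal.subset_span (by simp)
    · rw [hmA, Ideal.span_le, Set.insert_subset_iff, Set.insert_subset_iff, Set.singleton_subset_iff]
      have h1 : 𝔓 ≤ Ideal.span ({c' 0, algebraMap R (AdicCompletion (maximalIdeal R) R) w} :
          Set (AdicCompletion (maximalIdeal R) R)) := by
        rw [h𝔓def]; exact Ideal.span_mono (by simp)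
      exact ⟨h1 hy', h1 hv', Ideal.subset_span (by simp)⟩
  refine hq 𝔮 h𝔮ne hpair ?_
  -- the flat local homomorphism `A = R_𝔮 → B = R̂_𝔓` with regular closed fibre (`R` is a G-ring)
  set A := Localization.AtPrime 𝔮
  set B := Localization.AtPrime 𝔓
  haveI : 𝔓.LiesOver 𝔮 := ⟨rfl⟩
  letI : Algebra A B := Localization.AtPrime.algebraOfLiesOver 𝔮 𝔓
  have halg : algebraMap A B = Localization.localRingHom 𝔮 𝔓
      (algebraMap R (AdicCompletion (maximalIdeal R) R)) Ideal.LiesOver.over :=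
    Localization.AtPrime.IsLiesOverAlgebra.algebraMap_eq
  haveI : IsLocalHom (algebraMap A B) := by rw [halg]; infer_instance
  haveI : IsNoetherianRing (AdicCompletion (maximalIdeal R) R) :=
    isNoetherianRing_adicCompletion_maximalIdeal R
  haveI : IsLocalization.AtPrime R (maximalIdeal R) :=
    IsLocalization.of_le_isUnit fun x hx => by
      change IsUnit x
      have hx' : x ∉ maximalIdeal R := hx
      exact not_not.mp fun h => hx' ((mem_maximalIdeal x).mpr h)
  haveI : IsNoetherianRing A := inferInstance
  haveI : IsNoetherianRing B := inferInstance
  haveI : Module.Flat R B := Module.Flat.trans R (AdicCompletion (maximalIdeal R) R) B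
  haveI : Module.Flat A B :=
    (Module.flat_iff_of_isLocalization (S := A) 𝔮.primeCompl (M := B)).mpr inferInstance
  have hRH : IsRegularHom R (AdicCompletion (maximalIdeal R) R) :=
    hG.isRegularHom_completion_of_isLocalization_atPrime (maximalIdeal R) R
  have hF : IsRegularRing (𝔮.Fiber (AdicCompletion (maximalIdeal R) R)) := hRH.isRegularRing_fiber 𝔮
  have hreg₀ := isRegularLocalRing_quotient_of_isRegularRing_fiber (A := R)
    (B := AdicCompletion (maximalIdeal R) R) 𝔓 hF
  have hmax : (maximalIdeal A).map (algebraMap A B) = 𝔮.map (algebraMap R B) := by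
    rw [← Localization.AtPrime.map_eq_maximalIdeal, Ideal.map_map, ← IsScalarTower.algebraMap_eq]
  have hreg : IsRegularLocalRing (B ⧸ (maximalIdeal A).map (algebraMap A B)) := by
    rw [hmax]; exact hreg₀
  -- orders are preserved along `A → B`; `I R̂ ⊆ 𝔓^μ` gives `(I R̂) B ⊆ (𝔪_B)^μ`
  have hleB : (I.map (algebraMap R (AdicCompletion (maximalIdeal R) R))).map
      (algebraMap (AdicCompletion (maximalIdeal R) R) B) ≤ maximalIdeal B ^ μ := by
    rw [← Localization.AtPrime.map_eq_maximalIdeal, ← Ideal.map_pow]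
    exact Ideal.map_mono hleP
  rw [Ideal.map_le_iff_le_comap]
  intro f hf
  rw [Ideal.mem_comap, mem_pow_maximalIdeal_iff_of_isRegularLocalRing_fiber hreg μ]
  have h1 : algebraMap A B (algebraMap R A f) =
      algebraMap (AdicCompletion (maximalIdeal R) R) B
        (algebraMap R (AdicCompletion (maximalIdeal R) R) f) := by
    rw [← IsScalarTower.algebraMap_apply,
      IsScalarTower.algebraMap_apply R (AdicCompletion (maximalIdeal R) R) B]
  rw [h1]
  exact hleB (Ideal.mem_map_of_mem _ (Ideal.mem_map_of_mem _ hf))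

end NoSurface

end Literature.AlgebraicGeometry.Resolution

end
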